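import Summits.QuantumFields.YangMills.Theorems.UnitScaleTiltFluctuationComparisonRegPrRepAtHeightsUpperRow
import HarnessLib

/-!
# Route `UnitScaleTilt` — crux `FluctuationComparisonRegPrL` (stmt-QuantumFields-19935), v5h STUB 3′ `stub_alphaTwoRunOfLane`, conjunct (A)
# `RepAtHeights`: THE MASS-FREE (55)·(58) ROW AT THE TRIVIAL HISTORY AS THE ONLY INPUT BEYOND THE v2 PACKAGE — the consumer side of crux-idea C5
# `unfactored-trivial-row` / finding N7 (ym-cruxidea-19201-2 g6) and of ADDENDUM 2 (b′) (support file `--supports stmt-QuantumFields-19935`)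

Fleet seat `ym-ust-19201-p2` (gen 3, socket pen); evidence #18/#22/#26 on the item; continues `…RepAtHeightsUpperRow` (p504281: (A) ⟸ OfV2At ∧ `HaarCompatT3 F`).
WHY.  `HaarCompatT3 F` enters p504281 ONLY to turn the lane's residual row `Fibre49AC` at the trivial new history — whose right side carries the transported
trivial mass `T_k[w·m_k(triv)]` — into a MASS-FREE one-step bound.  Print's (49) ≤ (55)·(58) at the trivial history is UNFACTORED ([Balaban1985UV3] p.269, p.272
L32–33 «Ω_{k+1} = T_η»: the fibre integral's normalisation is evaluated into `E_{k+1}`, `𝒫_{k+1}`, `log Z^{(k)}(·, U_{k+1})` — the lane's own `Ecst`/`logZU`/`Pold`),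
so the natural (β) row at the trivial history has NO mass prefactor.  This file STATES that row inline over the lane's v2 record (hypothesis `hrow`: `Fibre49AC`'s
display at `h′ = triv′` with `w = 1`, `m_k(triv) = 1`, prefactor `1` — the `≤ᵐ` upper twin of `Fibre57LowAC`; a HYPOTHESIS SCHEMA, to be fed by the lane's v3-ready
row `Fibre55WinAC`/`Fibre55TrivAC`, ★pub-balaban3d-alpha-1 g3 06:21Z) and proves: `OfV2At.dataT3c_oneStepUpperTrivAt_of_fibre55Triv` (row ⇒ `OneStepUpperTrivAt (dataT3c …)`,
the gathering `ineq41_exponent_succ_le_triv` + homogeneity + window dictionary of p504281 with the mass lemmas deleted) and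
**`OfV2At.repAtHeights_dataT3c_of_fibre55Triv : (the rows ∀ K, k < K) → thresholds → RepAtHeights (dataT3c …) 𝔠.b₀ 𝔠.p₀ ε₀`** —
conjunct (A) ⟸ v2 package + ONE mass-free trivial-history row, no Haar compatibility.  Nothing of Bałaban's is asserted; standard axioms.

References: T. Bałaban, CMP 102 (1985) 255–275 [Balaban1985UV3] ((41) p.266, (49) p.268, (55)–(58) pp.269–270, p.272 L32–33).
-/

set_option autoImplicit false

noncomputable section

namespace Summit.QuantumFields.YangMills.Theorems

open MeasureTheory Filter
open Literature.MathematicalPhysics.QuantumFieldTheory.Balaban1983to89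
open Literature.MathematicalPhysics.QuantumFieldTheory.Balaban1983to89.B10
open Literature.MathematicalPhysics.QuantumFieldTheory.Balaban1983to89.B10SectAGathering
open Literature.MathematicalPhysics.QuantumFieldTheory.Balaban1983to89.AveragingRT (rnTransport)
open Literature.MathematicalPhysics.QuantumFieldTheory.Balaban1983to89.T3ContinuumYM3Torus
open Literature.MathematicalPhysics.QuantumFieldTheory.Balaban1983to89.T3UnitLawDensityEML (ℰp rt)
open Literature.MathematicalPhysics.QuantumFieldTheory.Balaban1983to89.T3UnitScaleTilt (θBal)
open Literature.MathematicalPhysics.QuantumFieldTheory.Balaban1983to89.T3LevelShift (fieldShift)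
open Literature.MathematicalPhysics.QuantumFieldTheory.Balaban1983to89.T3PrintedRegularMinimiser
open Literature.MathematicalPhysics.QuantumFieldTheory.Balaban1983to89.T3AlphaInputsAC
open Literature.MathematicalPhysics.QuantumFieldTheory.Balaban1983to89.T3AlphaInputsACTrivEnvelope
open Literature.MathematicalPhysics.QuantumFieldTheory.Balaban1985CMP102
open Literature.MathematicalPhysics.QuantumFieldTheory.Balaban1985CMP102.Setting
open Summit.QuantumFields.Balaban3D.Carriers
open Summit.QuantumFields.Balaban3D.Proofs.Primitives
open Summit.QuantumFields.Balaban3D.Proofs.TowerAC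
open Summit.QuantumFields.Balaban3D.Proofs.StandardAC
open Summit.QuantumFields.Balaban3D.Proofs.InputsAC
open Summit.QuantumFields.Balaban3D.Proofs.Bound55AC
open Summit.QuantumFields.Balaban3D.Proofs.Bound55Masses (chiB chiB_nonneg chiB_le_one measurable_chiB)
open Summit.QuantumFields.Balaban3D.Proofs.MassesAC
open Summit.QuantumFields.Balaban3D.Proofs.Thm2AC
open Summit.QuantumFields.Balaban3D.Proofs (Bound55Std.measurable_actionEta Bound55Std.actionEta_nonneg)
open Summit.QuantumFields.YangMills.Theorems.LogComparisonRepAtHeights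

/-! ## §1 The mass-free (55)·(58) row at the trivial history (stated inline as a hypothesis; no new definition)

THE ROW (hypothesis `hrow` below, never asserted): for every run `K` and step `k < K`, `Fibre49AC`'s display at `h′ = triv′` with the step weight
`w(triv′) = 1`, the trivial mass PINNED to `1` (print: `Ω_{k+1} = T_η`, nothing integrated) and prefactor `1` on the right —
`T_k[χB(ε₁)_k(triv′)·e^{(41)_k(triv)-exponent}] ≤ᵐ e^{(55)·(58)-exponent at triv′}` over the lane's v2 record `h.pkgAtV2 hc γ hγ hγ1 K`; the `≤ᵐ` twin of the
lane's `Fibre57LowAC`; crux-idea C5 `unfactored-trivial-row` (`Fibre55TrivAC`); to be fed by ★alpha-1's v3-ready `Fibre55WinAC` at the trivial history. -/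


/-! ## §2 The upper one-step trivial envelope of the lane's datum from the mass-free row -/

section Upper

variable {F : T3Family} {𝔠 : AlphaConsts F.L (suGroupModel 2).N} {a₀ a₁ : ℝ}
  (h : AlphaInputsT3AC.OfV2At F 𝔠 a₀ a₁) (hc : 0 < a₀ ∧ 0 < a₁ ∧ 𝔠.B₃ * a₁ ≤ a₀) (γ : ℝ) (hγ : 0 < γ)
  (hγ1 : γ ≤ (min 𝔠.gamma0 1) ^ 2) (π : AlphaInputsT3AC.PolymerT3 F)

open Classical in
/-- **THE UPPER ONE-STEP TRIVIAL ENVELOPE OF THE LANE'S DATUM FROM THE MASS-FREE ROW**: `(the mass-free rows ∀ K, k < K) → OneStepUpperTrivAt (dataT3c …) 𝔠.b₀ 𝔠.p₀ K k` —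
the row, the upper gathering at the trivial history (`ineq41_exponent_succ_le_triv` over `Thm2AC.stepLeavesOfAC`), homogeneity of the transport for the route normalisation
`e^{E}`, and the window dictionary `χB(ε₁)_k(triv′) = 𝟙[PlaqSmall θBal(K−k)]`.  No Haar compatibility, no mass. [cite: Balaban1985UV3, (41) p.266 and (55)-(58) pp.269-270] -/
theorem AlphaInputsT3AC.OfV2At.dataT3c_oneStepUpperTrivAt_of_fibre55Triv
    (hrow : ∀ (K k : ℕ), k + 1 ≤ K →
      (rnTransport (((h.pkgAtV2 hc γ hγ hγ1 K).X).av k).avg (fun U =>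
          chiB 𝔠.lane.carrier.M₁ (rcolOf (T3Scales F γ hγ (hγ1.trans (sq_min_one_le _ 𝔠.gamma0_pos)) K) 𝔠.lane.carrier)
              (eps1Of (T3Scales F γ hγ (hγ1.trans (sq_min_one_le _ 𝔠.gamma0_pos)) K) 𝔠.lane.carrier) k (Hist.triv (F.P K) (k + 1)) U *
            Real.exp (-((h.pkgAtV2 hc γ hγ hγ1 K).T.mainT k ((h.pkgAtV2 hc γ hγ hγ1 K).T.triv k) U) + (h.pkgAtV2 hc γ hγ hγ1 K).T.Pint k ((h.pkgAtV2 hc γ hγ hγ1 K).T.triv k) U - (h.pkgAtV2 hc γ hγ hγ1 K).T.Ecst k + (h.pkgAtV2 hc γ hγ hγ1 K).T.Zterm k ((h.pkgAtV2 hc γ hγ hγ1 K).T.triv k) + (h.pkgAtV2 hc γ hγ hγ1 K).T.Rm k)))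
        ≤ᵐ[fieldMeasure (F.P K) (k + 1) (Matrix.specialUnitaryGroup (Fin 2) ℂ)] fun V =>
          Real.exp (-((h.pkgAtV2 hc γ hγ hγ1 K).T.mainT (k + 1) ((h.pkgAtV2 hc γ hγ hγ1 K).T.triv (k + 1)) V) - (h.pkgAtV2 hc γ hγ hγ1 K).T.Ecst k
            + ((piecesAC 𝔠.lane (h.pkgAtV2 hc γ hγ hγ1 K).X (h.pkgAtV2 hc γ hγ hγ1 K).𝔖 k).logσ₀ + (piecesAC 𝔠.lane (h.pkgAtV2 hc γ hγ hγ1 K).X (h.pkgAtV2 hc γ hγ hγ1 K).𝔖 k).dg *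
                Real.log ((T3Scales F γ hγ (hγ1.trans (sq_min_one_le _ 𝔠.gamma0_pos)) K).gk k)) * (piecesAC 𝔠.lane (h.pkgAtV2 hc γ hγ hγ1 K).X (h.pkgAtV2 hc γ hγ hγ1 K).𝔖 k).starB ((h.pkgAtV2 hc γ hγ hγ1 K).T.triv (k + 1))
            + (piecesAC 𝔠.lane (h.pkgAtV2 hc γ hγ hγ1 K).X (h.pkgAtV2 hc γ hγ hγ1 K).𝔖 k).logZU ((h.pkgAtV2 hc γ hγ hγ1 K).T.triv (k + 1)) V + (piecesAC 𝔠.lane (h.pkgAtV2 hc γ hγ hγ1 K).X (h.pkgAtV2 hc γ hγ hγ1 K).𝔖 k).Pold ((h.pkgAtV2 hc γ hγ hγ1 K).T.triv (k + 1)) V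
            + (h.pkgAtV2 hc γ hγ hγ1 K).T.Zterm k ((piecesAC 𝔠.lane (h.pkgAtV2 hc γ hγ hγ1 K).X (h.pkgAtV2 hc γ hγ hγ1 K).𝔖 k).proj ((h.pkgAtV2 hc γ hγ hγ1 K).T.triv (k + 1))) + (h.pkgAtV2 hc γ hγ hγ1 K).T.Rm k + (piecesAC 𝔠.lane (h.pkgAtV2 hc γ hγ hγ1 K).X (h.pkgAtV2 hc γ hγ hγ1 K).𝔖 k).logFl ((h.pkgAtV2 hc γ hγ hγ1 K).T.triv (k + 1)) V)) (K k : ℕ) (hk : k + 1 ≤ K) :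
    OneStepUpperTrivAt (h.dataT3c hc γ hγ hγ1 π) 𝔠.b₀ 𝔠.p₀ K k hk := by
  -- the package's data of run `K`, its (α) step row at `k`, the step leaves, the gathering
  have hle := T3Scales_window F 𝔠 γ hγ hγ1 K
  have st := (h.pkgAtV2 hc γ hγ hγ1 K).run.steps k hk
  have R := stepResidualsAC_of_alpha hle k hk st
  have hgath := fun U => ineq41_exponent_succ_le_triv_of_leaves (stepLeavesOfAC k hk R) hk U
  have h49 := hrow K k hk
  -- abbreviations in the tower's letters
  let T : TowerRun := (h.pkgAtV2 hc γ hγ hγ1 K).T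
  let E : ℝ := (h.pkgAtV2 hc γ hγ hγ1 K).E
  let Pc := piecesAC 𝔠.lane (h.pkgAtV2 hc γ hγ hγ1 K).X (h.pkgAtV2 hc γ hγ hγ1 K).𝔖 k
  let S₃ := T3Scales F γ hγ (hγ1.trans (sq_min_one_le _ 𝔠.gamma0_pos)) K
  -- the averaging of the package IS the route's, exactly Haar compatible by `hH`
  have hkm : k + 1 ≤ F.m + K := by omega
  have hav : ∀ j, j + 1 ≤ F.m + K → ((h.pkgAtV2 hc γ hγ hγ1 K).X).av j = BlockAveraging.blockAvg (P := F.P K) (j := j) ℰp :=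
    fun j hj => avT3_of_le F K hj
  have hrtT : ∀ g : GaugeField (F.P K) k (Matrix.specialUnitaryGroup (Fin 2) ℂ) → ℝ,
      (rt F K k hkm).T g = rnTransport (((h.pkgAtV2 hc γ hγ hγ1 K).X).av k).avg g := fun g => by
    rw [hav k hkm]; rfl
  have hε1 : eps1Of S₃ 𝔠.lane.carrier k = θBal F.L γ 𝔠.b₀ 𝔠.p₀ (K - k) :=
    (h.pkgAtV2 hc γ hγ hγ1 K).toPkgAt.eps1_eq k (by omega)
  -- the (41)-trivial integrand of `Fibre49AC` and its relation to the upper envelope of the datum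
  let g : GaugeField (F.P K) k (Matrix.specialUnitaryGroup (Fin 2) ℂ) → ℝ := fun U =>
    Real.exp (-(T.mainT k (T.triv k) U) + T.Pint k (T.triv k) U - T.Ecst k + T.Zterm k (T.triv k) + T.Rm k)
  have hZk : T.Zterm k (T.triv k) = 0 := T.Zterm_triv k
  have hup_eq : ∀ U, upperTriv (h.dataT3c hc γ hγ hγ1 π) K k U = Real.exp E * g U := by
    intro U
    rw [upperTriv_eq_exp]
    show Real.exp ((-(T.mainT k (T.triv k) U) + T.Pint k (T.triv k) U - (T.Ecst k - E)) + T.Rm k) =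
      Real.exp E * Real.exp (-(T.mainT k (T.triv k) U) + T.Pint k (T.triv k) U - T.Ecst k + T.Zterm k (T.triv k) + T.Rm k)
    rw [hZk, ← Real.exp_add]
    congr 1
    ring
  -- the mass and the weights of the AC tower at the trivial history
  let χ : GaugeField (F.P K) k (Matrix.specialUnitaryGroup (Fin 2) ℂ) → ℝ := fun U =>
    chiB 𝔠.lane.carrier.M₁ (rcolOf S₃ 𝔠.lane.carrier) (eps1Of S₃ 𝔠.lane.carrier) k (Hist.triv (F.P K) (k + 1)) U
  let cg : GaugeField (F.P K) k (Matrix.specialUnitaryGroup (Fin 2) ℂ) → ℝ := fun U => χ U * g U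
  -- the (49)-factor at the trivial new history IS the window indicator of level `k`
  have hchiB : ∀ (f : GaugeField (F.P K) k (Matrix.specialUnitaryGroup (Fin 2) ℂ) → ℝ) (U : GaugeField (F.P K) k (Matrix.specialUnitaryGroup (Fin 2) ℂ)),
      χ U * f U = {W' : GaugeField (F.P K) k (Matrix.specialUnitaryGroup (Fin 2) ℂ) | PlaqSmall (θBal F.L γ 𝔠.b₀ 𝔠.p₀ (K - k)) W'}.indicator f U := by
    intro f U
    have e : χ U = if PlaqSmall (eps1Of S₃ 𝔠.lane.carrier k) U then 1 else 0 :=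
      Balaban3D.Proofs.FibreClash.chiB_triv_eq (S := S₃) k 𝔠.lane.carrier.M₁ (rcolOf S₃ 𝔠.lane.carrier) (eps1Of S₃ 𝔠.lane.carrier) U
    rw [e, hε1]
    by_cases hU : PlaqSmall (θBal F.L γ 𝔠.b₀ 𝔠.p₀ (K - k)) U
    · rw [if_pos hU, one_mul, Set.indicator_of_mem (show U ∈ {W' | PlaqSmall (θBal F.L γ 𝔠.b₀ 𝔠.p₀ (K - k)) W'} from hU)]
    · rw [if_neg hU, zero_mul, Set.indicator_of_notMem (show U ∉ {W' | PlaqSmall (θBal F.L γ 𝔠.b₀ 𝔠.p₀ (K - k)) W'} from hU)]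
  -- integrability of `χ·g` (bounded measurable weight times the exponential of a measurable exponent bounded above)
  have hmain : ∀ U, T.mainT k (T.triv k) U = (S₃.gk k)⁻¹ ^ 2 * S₃.actionEta k ((h.pkgAtV2 hc γ hγ hγ1 K).UkH k (Hist.triv (F.P K) k) U) :=
    fun _ => rfl
  have hgi : Integrable cg (fieldMeasure (F.P K) k (Matrix.specialUnitaryGroup (Fin 2) ℂ)) := by
    refine Balaban3D.Proofs.Transport48.integrable_weight_mul_exp (measurable_chiB _ _ _ k _) (chiB_nonneg _ _ _ k _) (chiB_le_one _ _ _ k _)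
      ?_ (c := (h.pkgAtV2 hc γ hγ hγ1 K).𝔄.cP k - T.Ecst k + T.Zterm k (T.triv k) + T.Rm k) ?_
    · simp_rw [hmain]
      exact ((((measurable_const.mul ((Bound55Std.measurable_actionEta (S := S₃) k).comp (st.hU _))).neg.add (st.hPm _)).sub
        measurable_const).add measurable_const).add measurable_const
    · intro U
      have h0 : 0 ≤ T.mainT k (T.triv k) U := by
        rw [hmain]; exact mul_nonneg (sq_nonneg _) (Bound55Std.actionEta_nonneg (S := S₃) k _)
      have h2 : T.Pint k (T.triv k) U ≤ (h.pkgAtV2 hc γ hγ hγ1 K).𝔄.cP k := st.hPb _ U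
      linarith
  -- homogeneity for the route normalisation `e^{E}`
  have hhom := rnTransport_const_mul_ae (((h.pkgAtV2 hc γ hγ hγ1 K).X).av k).avg cg
    (fun U => mul_nonneg (chiB_nonneg _ _ _ k _ U) (Real.exp_pos _).le) hgi (Real.exp_nonneg E)
  -- the restricted upper envelope of level `k` IS `e^{E}·χ·g`
  have hind : {W' : GaugeField (F.P K) k (Matrix.specialUnitaryGroup (Fin 2) ℂ) | PlaqSmall (θBal F.L γ 𝔠.b₀ 𝔠.p₀ (K - k)) W'}.indicator
      (upperTriv (h.dataT3c hc γ hγ hγ1 π) K k) = fun U => Real.exp E * cg U := by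
    funext U
    rw [← hchiB _ U, hup_eq U]
    show χ U * (Real.exp E * g U) = Real.exp E * (χ U * g U)
    ring
  -- the goal
  show ∀ᵐ W ∂fieldMeasure (F.P K) (k + 1) (Matrix.specialUnitaryGroup (Fin 2) ℂ),
    PlaqSmall (θBal F.L γ 𝔠.b₀ 𝔠.p₀ (K - (k + 1))) W →
      (rt F K k hkm).T ({W' : GaugeField (F.P K) k (Matrix.specialUnitaryGroup (Fin 2) ℂ) |
          PlaqSmall (θBal F.L γ 𝔠.b₀ 𝔠.p₀ (K - k)) W'}.indicator (upperTriv (h.dataT3c hc γ hγ hγ1 π) K k)) W ≤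
        upperTriv (h.dataT3c hc γ hγ hγ1 π) K (k + 1) W
  rw [hind, hrtT]
  filter_upwards [h49, hhom] with W h49W hhomW
  intro _
  -- the upper envelope of level `k+1` in the tower's letters
  have hup1 : upperTriv (h.dataT3c hc γ hγ hγ1 π) K (k + 1) W =
      Real.exp E * Real.exp (-(T.mainT (k + 1) (T.triv (k + 1)) W) + T.Pint (k + 1) (T.triv (k + 1)) W - T.Ecst (k + 1)
        + T.Zterm (k + 1) (T.triv (k + 1)) + T.Rm (k + 1)) := by
    rw [upperTriv_eq_exp, T.Zterm_triv (k + 1)]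
    show Real.exp ((-(T.mainT (k + 1) (T.triv (k + 1)) W) + T.Pint (k + 1) (T.triv (k + 1)) W - (T.Ecst (k + 1) - E)) + T.Rm (k + 1)) = _
    rw [← Real.exp_add]
    congr 1
    ring
  -- the (α) row, the trivial mass `≤ 1`, the gathering
  have key : rnTransport (((h.pkgAtV2 hc γ hγ hγ1 K).X).av k).avg cg W ≤
      Real.exp (-(T.mainT (k + 1) (T.triv (k + 1)) W) + T.Pint (k + 1) (T.triv (k + 1)) W - T.Ecst (k + 1)
        + T.Zterm (k + 1) (T.triv (k + 1)) + T.Rm (k + 1)) :=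
    calc rnTransport (((h.pkgAtV2 hc γ hγ hγ1 K).X).av k).avg cg W
        ≤ Real.exp (-(T.mainT (k + 1) (T.triv (k + 1)) W) - T.Ecst k
              + (Pc.logσ₀ + Pc.dg * Real.log (S₃.gk k)) * Pc.starB (T.triv (k + 1)) + Pc.logZU (T.triv (k + 1)) W + Pc.Pold (T.triv (k + 1)) W
              + T.Zterm k (Pc.proj (T.triv (k + 1))) + T.Rm k + Pc.logFl (T.triv (k + 1)) W) := h49W
      _ ≤ Real.exp (-(T.mainT (k + 1) (T.triv (k + 1)) W) + T.Pint (k + 1) (T.triv (k + 1)) W - T.Ecst (k + 1)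
              + T.Zterm (k + 1) (T.triv (k + 1)) + T.Rm (k + 1)) := Real.exp_le_exp.mpr (hgath W)
  rw [hup1]
  calc rnTransport (((h.pkgAtV2 hc γ hγ hγ1 K).X).av k).avg (fun U => Real.exp E * cg U) W
      = Real.exp E * rnTransport (((h.pkgAtV2 hc γ hγ hγ1 K).X).av k).avg cg W := hhomW
    _ ≤ Real.exp E * Real.exp (-(T.mainT (k + 1) (T.triv (k + 1)) W) + T.Pint (k + 1) (T.triv (k + 1)) W - T.Ecst (k + 1)
        + T.Zterm (k + 1) (T.triv (k + 1)) + T.Rm (k + 1)) := mul_le_mul_of_nonneg_left key (Real.exp_nonneg E)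

end Upper

/-! ## §3 Conjunct (A) at the datum from the v2 package and the mass-free row -/

section Assembly

variable {F : T3Family} {𝔠 : AlphaConsts F.L (suGroupModel 2).N} {a₀ a₁ : ℝ}
  (h : AlphaInputsT3AC.OfV2At F 𝔠 a₀ a₁) (hc : 0 < a₀ ∧ 0 < a₁ ∧ 𝔠.B₃ * a₁ ≤ a₀) (γ : ℝ) (hγ : 0 < γ)
  (hγ1 : γ ≤ (min 𝔠.gamma0 1) ^ 2) (π : AlphaInputsT3AC.PolymerT3 F)

/-- **CONJUNCT (A) OF v5h STUB 3′ AT THE LANE'S DATUM FROM THE v2 (α) PACKAGE AND THE MASS-FREE TRIVIAL-HISTORY ROW** (no Haar compatibility): given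
`OfV2At F 𝔠 a₀ a₁`, the mass-free trivial-history rows (`hrow`) at every step of every run, and the adapter's thresholds, `RepAtHeights (OfV2At.dataT3c …) 𝔠.b₀ 𝔠.p₀ ε₀`.
[cite: Balaban1985UV3, (41) p.266, (47) p.267 and (55)-(58) pp.269-270] -/
theorem AlphaInputsT3AC.OfV2At.repAtHeights_dataT3c_of_fibre55Triv
    (hrow : ∀ (K k : ℕ), k + 1 ≤ K →
      (rnTransport (((h.pkgAtV2 hc γ hγ hγ1 K).X).av k).avg (fun U =>
          chiB 𝔠.lane.carrier.M₁ (rcolOf (T3Scales F γ hγ (hγ1.trans (sq_min_one_le _ 𝔠.gamma0_pos)) K) 𝔠.lane.carrier)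
              (eps1Of (T3Scales F γ hγ (hγ1.trans (sq_min_one_le _ 𝔠.gamma0_pos)) K) 𝔠.lane.carrier) k (Hist.triv (F.P K) (k + 1)) U *
            Real.exp (-((h.pkgAtV2 hc γ hγ hγ1 K).T.mainT k ((h.pkgAtV2 hc γ hγ hγ1 K).T.triv k) U) + (h.pkgAtV2 hc γ hγ hγ1 K).T.Pint k ((h.pkgAtV2 hc γ hγ hγ1 K).T.triv k) U - (h.pkgAtV2 hc γ hγ hγ1 K).T.Ecst k + (h.pkgAtV2 hc γ hγ hγ1 K).T.Zterm k ((h.pkgAtV2 hc γ hγ hγ1 K).T.triv k) + (h.pkgAtV2 hc γ hγ hγ1 K).T.Rm k)))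
        ≤ᵐ[fieldMeasure (F.P K) (k + 1) (Matrix.specialUnitaryGroup (Fin 2) ℂ)] fun V =>
          Real.exp (-((h.pkgAtV2 hc γ hγ hγ1 K).T.mainT (k + 1) ((h.pkgAtV2 hc γ hγ hγ1 K).T.triv (k + 1)) V) - (h.pkgAtV2 hc γ hγ hγ1 K).T.Ecst k
            + ((piecesAC 𝔠.lane (h.pkgAtV2 hc γ hγ hγ1 K).X (h.pkgAtV2 hc γ hγ hγ1 K).𝔖 k).logσ₀ + (piecesAC 𝔠.lane (h.pkgAtV2 hc γ hγ hγ1 K).X (h.pkgAtV2 hc γ hγ hγ1 K).𝔖 k).dg *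
                Real.log ((T3Scales F γ hγ (hγ1.trans (sq_min_one_le _ 𝔠.gamma0_pos)) K).gk k)) * (piecesAC 𝔠.lane (h.pkgAtV2 hc γ hγ hγ1 K).X (h.pkgAtV2 hc γ hγ hγ1 K).𝔖 k).starB ((h.pkgAtV2 hc γ hγ hγ1 K).T.triv (k + 1))
            + (piecesAC 𝔠.lane (h.pkgAtV2 hc γ hγ hγ1 K).X (h.pkgAtV2 hc γ hγ hγ1 K).𝔖 k).logZU ((h.pkgAtV2 hc γ hγ hγ1 K).T.triv (k + 1)) V + (piecesAC 𝔠.lane (h.pkgAtV2 hc γ hγ hγ1 K).X (h.pkgAtV2 hc γ hγ hγ1 K).𝔖 k).Pold ((h.pkgAtV2 hc γ hγ hγ1 K).T.triv (k + 1)) V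
            + (h.pkgAtV2 hc γ hγ hγ1 K).T.Zterm k ((piecesAC 𝔠.lane (h.pkgAtV2 hc γ hγ hγ1 K).X (h.pkgAtV2 hc γ hγ hγ1 K).𝔖 k).proj ((h.pkgAtV2 hc γ hγ hγ1 K).T.triv (k + 1))) + (h.pkgAtV2 hc γ hγ hγ1 K).T.Rm k + (piecesAC 𝔠.lane (h.pkgAtV2 hc γ hγ hγ1 K).X (h.pkgAtV2 hc γ hγ hγ1 K).𝔖 k).logFl ((h.pkgAtV2 hc γ hγ hγ1 K).T.triv (k + 1)) V))
    (ε₀ : ℝ) (hε : 0 < ε₀) (hhi : ε₀ ≤ a₀)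
    (ha₁ : ∀ n, θBal F.L γ 𝔠.b₀ 𝔠.p₀ n ≤ a₁) (hlo : ∀ n, 𝔠.B₃ * θBal F.L γ 𝔠.b₀ 𝔠.p₀ n ≤ ε₀)
    (h4 : ∀ n, 4 * θBal F.L γ 𝔠.b₀ 𝔠.p₀ n < ε₀) :
    RepAtHeights (h.dataT3c hc γ hγ hγ1 π) 𝔠.b₀ 𝔠.p₀ ε₀ :=
  h.repAtHeights_dataT3c_of_upperRows hc γ hγ hγ1 π ε₀ hε hhi ha₁ hlo h4
    (fun K j hjK => h.dataT3c_oneStepUpperTrivAt_of_fibre55Triv hc γ hγ hγ1 π hrow K j hjK)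

end Assembly

end Summit.QuantumFields.YangMills.Theorems

end
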